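import Mathlib
import Summits.NavierStokesRegularity.NavierStokesRegularity.Theorems.RotatedEulerWindowDecayFluxRecurrenceLiouville
import Literature.Analysis.FluidPDE.VectorCalculusProofs
import Summits.NavierStokesRegularity.NavierStokesRegularity.Theses.RotatedEulerWindow
import HarnessLib

/-!
# `RotatedEulerWindow.DecayFluxRecurrence` — decay forces recurrence of vortex lines
  (route `RotatedEulerWindow`, item stmt-NavierStokesRegularity-19348, support = stub S1 of the
  registered skeleton of crux `EmptyRotatedEulerWindow`; its corollary is route `VortexLineClock`'s
  `FluxCapacityRecurrence`, stmt-NavierStokesRegularity-11276)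

**Statement.** Let `Ω = m⁻¹ curl U` (`U ∈ C²`, `m > 0`) be a `C¹`, globally Lipschitz vorticity
field on `ℝ³` with `‖Ω y‖ ≤ C (1 + ‖y‖)^(-1/β)`, `0 < β < 1/2`. Then for almost every `y` (the
guard `Ω y ≠ 0` is not needed), every integral curve `x` of `Ω` with `x 0 = y` returns to every
`ε`-ball about `y` at arbitrarily late times.

PROOF (the refuters'/grounders' plan on the item, g43-30/g43-37/g43-34/critic-2 g7, g20-41/g20-42:
"volume growth" instead of a flux count).
1. *Complete volume-preserving flow.* `Ω` is globally Lipschitz, so its flow `Ψ` is global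
   (`Literature.Analysis.ODE.lipschitzFlow`); `div Ω = m⁻¹ div curl U = 0`
   (`divergence_curl_eq_zero_holds`), so by Liouville's theorem (tools file
   `RotatedEulerWindowDecayFluxRecurrenceLiouville`: variational equation + Abel–Liouville–Jacobi
   formula + area formula) the time-one map `f = Ψ(·, 1)` preserves Lebesgue measure.
2. *Slow escape* (`DecayFlux.rpow_norm_flow_le`): with `a = 1/β`, the function
   `(1 + ‖Ψ(q, s)‖²)^((1+a)/2)` is `(1+a)C`-Lipschitz in `s` (its derivative is
   `(1+a)⟪x, Ω x⟫(1+‖x‖²)^((a-1)/2)`, bounded by `(1+a)C` thanks to the decay), so a point whose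
   orbit visits `B̄_{R₀}` at time `k ≤ n` lies in `B̄_{R(n)}`, `R(n) = (G₀ + (1+a)C n)^(1/(1+a))`.
3. *No wandering set* (`DecayFlux.conservative_flow_one`): if a measurable `s` had no returning
   point, `W = s ∩ B̄_{R₀}` (positive measure for some `R₀`) would have pairwise disjoint preimages
   `(f^k)⁻¹ W`, `k ≤ n`, all of measure `vol W` and all inside `B̄_{R(n)}`, whence
   `(n+1) vol W ≤ vol B̄₁ · R(n)³ = O(n^(3/(1+a)))` with `3/(1+a) < 1` because `a > 2` (this is
   exactly where `β < 1/2` strict enters): `vol W = 0`, absurd. So `f` is CONSERVATIVE.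
4. *Recurrence.* Mathlib's `Conservative.ae_frequently_mem_of_mem_nhds`: a.e. `y` returns to each
   of its neighbourhoods at infinitely many integer times; the integral curve through `y` is the
   flow line (`eq_lipschitzFlow_of_hasDerivAt`), and `f^n y = Ψ(y, n)`.

References: Constantin–Ignatova–Vicol (putative 2026) §3.1; Majda–Bertozzi 2002 §1.3; V. I. Arnold,
*Mathematical Methods*, §16; P. R. Halmos, *Lectures on Ergodic Theory* (recurrence).

HONEST FRAMING: a dynamical lemma (Liouville + Poincaré–Halmos recurrence) about the vortex-line
flow of HYPOTHETICAL self-similar profiles; nothing here bears on the regularity problem itself.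
-/

noncomputable section

set_option linter.dupNamespace false

namespace Summit.NavierStokesRegularity.NavierStokesRegularity.Theorems

open Set Function Filter Topology MeasureTheory Metric
open scoped NNReal ENNReal ContDiff RealInnerProductSpace
open Literature.Analysis.ODE

namespace DecayFlux

/-! ### Slow escape: the growth bound along trajectories of a decaying field -/

section Growth

variable {F : Type*} [NormedAddCommGroup F] [InnerProductSpace ℝ F] [CompleteSpace F]

omit [CompleteSpace F] in
/-- The elementary inequality `r (1 + r²)^((a-1)/2) ≤ (1 + r)^a` for `r ≥ 0`, `a ≥ 1`. -/
theorem mul_rpow_le_one_add_rpow {a : ℝ} (ha : 1 ≤ a) {r : ℝ} (hr : 0 ≤ r) :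
    r * (1 + r ^ 2) ^ ((a - 1) / 2) ≤ (1 + r) ^ a := by
  have h0 : 0 < 1 + r := by linarith
  have h1 : (1 + r ^ 2) ^ ((a - 1) / 2) ≤ (1 + r) ^ (a - 1) := by
    have hsq : 1 + r ^ 2 ≤ (1 + r) ^ 2 := by nlinarith
    calc (1 + r ^ 2) ^ ((a - 1) / 2) ≤ ((1 + r) ^ 2) ^ ((a - 1) / 2) :=
          Real.rpow_le_rpow (by positivity) hsq (by linarith)
      _ = (1 + r) ^ (a - 1) := by
          rw [show ((1 + r) ^ 2 : ℝ) = (1 + r) ^ (2 : ℝ) by norm_cast, ← Real.rpow_mul h0.le]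
          congr 1
          ring
  calc r * (1 + r ^ 2) ^ ((a - 1) / 2) ≤ (1 + r) * (1 + r) ^ (a - 1) :=
        mul_le_mul (by linarith) h1 (Real.rpow_nonneg (by positivity) _) h0.le
    _ = (1 + r) ^ a := by
        rw [mul_comm, ← Real.rpow_add_one h0.ne']
        congr 1
        ring

/-- **Slow escape.** For a globally Lipschitz field `g` with `‖g y‖ ≤ C (1 + ‖y‖)^(-a)`, `a ≥ 1`,
every trajectory of the global flow satisfies
`(1 + ‖Ψ q t‖²)^((1+a)/2) ≤ (1 + ‖q‖²)^((1+a)/2) + (1+a) C |t|`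
(the function `(1 + ‖x(s)‖²)^((1+a)/2)` is `(1+a)C`-Lipschitz along the trajectory). [folklore] -/
theorem rpow_norm_flow_le {g : F → F} {K : ℝ≥0} (hK : LipschitzWith K g) {C a : ℝ} (ha : 1 ≤ a)
    (hC : 0 ≤ C) (hdec : ∀ y, ‖g y‖ ≤ C * (1 + ‖y‖) ^ (-a)) (q : F) (t : ℝ) :
    (1 + ‖lipschitzFlow hK q t‖ ^ 2) ^ ((1 + a) / 2) ≤
      (1 + ‖q‖ ^ 2) ^ ((1 + a) / 2) + (1 + a) * C * |t| := by
  obtain ⟨γ, hγ⟩ : ∃ γ : ℝ → F, γ = lipschitzFlow hK q := ⟨_, rfl⟩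
  obtain ⟨p, hp⟩ : ∃ p : ℝ, p = (1 + a) / 2 := ⟨_, rfl⟩
  have hp0 : 0 ≤ p := by rw [hp]; positivity
  have hp1 : p - 1 = (a - 1) / 2 := by rw [hp]; ring
  obtain ⟨G, hG⟩ : ∃ G : ℝ → ℝ, G = fun s => (1 + ‖γ s‖ ^ 2) ^ p := ⟨_, rfl⟩
  -- the derivative of `G`
  have hGd : ∀ s, HasDerivAt G (2 * ⟪γ s, g (γ s)⟫ * p * (1 + ‖γ s‖ ^ 2) ^ (p - 1)) s := by
    intro s
    have h1 : HasDerivAt (fun s => ‖γ s‖ ^ 2) (2 * ⟪γ s, g (γ s)⟫) s := by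
      have h := (hasDerivAt_lipschitzFlow hK q s).norm_sq
      rw [← hγ] at h
      exact h
    have h2 : HasDerivAt (fun s => 1 + ‖γ s‖ ^ 2) (2 * ⟪γ s, g (γ s)⟫) s := by
      simpa using h1.const_add 1
    have h3 := h2.rpow_const (p := p) (Or.inl (by positivity))
    rw [hG]
    exact h3
  -- the bound on the derivative
  have hbd : ∀ s, |2 * ⟪γ s, g (γ s)⟫ * p * (1 + ‖γ s‖ ^ 2) ^ (p - 1)| ≤ (1 + a) * C := by
    intro s
    have hr : 0 ≤ ‖γ s‖ := norm_nonneg _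
    have h1r : 0 < 1 + ‖γ s‖ := by linarith
    have hX : 0 ≤ (1 + ‖γ s‖ ^ 2) ^ (p - 1) := Real.rpow_nonneg (by positivity) _
    have hin : |⟪γ s, g (γ s)⟫| ≤ ‖γ s‖ * (C * (1 + ‖γ s‖) ^ (-a)) :=
      (abs_real_inner_le_norm _ _).trans (mul_le_mul_of_nonneg_left (hdec _) hr)
    have hkey : ‖γ s‖ * (1 + ‖γ s‖ ^ 2) ^ (p - 1) ≤ (1 + ‖γ s‖) ^ a := by
      rw [hp1]
      exact mul_rpow_le_one_add_rpow ha hr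
    have hcancel : (1 + ‖γ s‖) ^ (-a) * (1 + ‖γ s‖) ^ a = 1 := by
      rw [Real.rpow_neg h1r.le, inv_mul_cancel₀ (Real.rpow_pos_of_pos h1r a).ne']
    calc |2 * ⟪γ s, g (γ s)⟫ * p * (1 + ‖γ s‖ ^ 2) ^ (p - 1)|
        = 2 * |⟪γ s, g (γ s)⟫| * p * (1 + ‖γ s‖ ^ 2) ^ (p - 1) := by
          rw [abs_mul, abs_mul, abs_mul, abs_of_nonneg hp0, abs_of_nonneg hX, abs_two]
      _ ≤ 2 * (‖γ s‖ * (C * (1 + ‖γ s‖) ^ (-a))) * p * (1 + ‖γ s‖ ^ 2) ^ (p - 1) := by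
          gcongr
      _ = 2 * p * C * ((1 + ‖γ s‖) ^ (-a) * (‖γ s‖ * (1 + ‖γ s‖ ^ 2) ^ (p - 1))) := by ring
      _ ≤ 2 * p * C * ((1 + ‖γ s‖) ^ (-a) * (1 + ‖γ s‖) ^ a) := by
          gcongr
      _ = (1 + a) * C := by rw [hcancel, mul_one, hp]; ring
  -- `G` is Lipschitz, hence the bound
  have hGdiff : Differentiable ℝ G := fun s => (hGd s).differentiableAt
  have hLip : LipschitzWith ⟨(1 + a) * C, by positivity⟩ G := by
    refine lipschitzWith_of_nnnorm_deriv_le hGdiff fun s => ?_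
    rw [(hGd s).deriv, ← NNReal.coe_le_coe, coe_nnnorm, Real.norm_eq_abs]
    exact hbd s
  have hdist : dist (G t) (G 0) ≤ (1 + a) * C * dist t 0 := hLip.dist_le_mul t 0
  rw [Real.dist_eq, Real.dist_eq, sub_zero] at hdist
  have hG0 : G 0 = (1 + ‖q‖ ^ 2) ^ p := by rw [hG, hγ]; simp
  have hGt : G t = (1 + ‖lipschitzFlow hK q t‖ ^ 2) ^ p := by rw [hG, hγ]
  rw [← hp, ← hGt, ← hG0]
  linarith [le_abs_self (G t - G 0)]

omit [CompleteSpace F] in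
/-- From the growth bound to a radius: `(1 + r²)^((1+a)/2) ≤ Y` (`r ≥ 0`, `a ≥ 1`) forces
`r ≤ Y^(1/(1+a))`. -/
theorem le_rpow_of_rpow_one_add_sq_le {a r Y : ℝ} (ha : 1 ≤ a) (hr : 0 ≤ r)
    (h : (1 + r ^ 2) ^ ((1 + a) / 2) ≤ Y) : r ≤ Y ^ (1 / (1 + a)) := by
  have ha0 : 0 < 1 + a := by linarith
  have hY : 0 ≤ Y := le_trans (Real.rpow_nonneg (by positivity) _) h
  have h1 : 1 + r ^ 2 ≤ Y ^ (2 / (1 + a)) := by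
    have h2 := Real.rpow_le_rpow (Real.rpow_nonneg (by positivity) _) h
      (by positivity : (0 : ℝ) ≤ 2 / (1 + a))
    rwa [← Real.rpow_mul (by positivity), show (1 + a) / 2 * (2 / (1 + a)) = (1 : ℝ) by
      field_simp, Real.rpow_one] at h2
  have h3 : r ^ 2 ≤ (Y ^ (1 / (1 + a))) ^ 2 := by
    rw [← Real.rpow_natCast (Y ^ (1 / (1 + a))) 2, ← Real.rpow_mul hY]
    rw [show 1 / (1 + a) * ((2 : ℕ) : ℝ) = 2 / (1 + a) by push_cast; ring]
    linarith
  exact (pow_le_pow_iff_left₀ hr (Real.rpow_nonneg hY _) two_ne_zero).1 h3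

end Growth


/-! ### No wandering sets: the time-one map is conservative -/

section Conservative

/-- **Poincaré–Halmos by volume growth.** On `ℝ³`, the time-one map of the global flow of a `C¹`,
globally Lipschitz, divergence-free field with the decay `‖g y‖ ≤ C (1 + ‖y‖)^(-a)`, `a > 2`, is
CONSERVATIVE for Lebesgue measure: if a measurable `s` had no returning point, a bounded piece
`W = s ∩ B̄_{R₀}` of positive measure would have pairwise disjoint preimages `(f^k)⁻¹ W`, `k ≤ n`, of
equal measure (Liouville), all inside the ball of radius `R(n) = (G₀ + (1+a)C n)^(1/(1+a))` (slow
escape), whence `(n+1)·vol W ≤ vol B̄_{R(n)} = O(n^(3/(1+a))) = o(n)` — absurd. [folklore] -/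
theorem conservative_flow_one {g : EuclideanSpace ℝ (Fin 3) → EuclideanSpace ℝ (Fin 3)} {K : ℝ≥0}
    (hK : LipschitzWith K g) (hg : ContDiff ℝ 1 g)
    (hdiv : ∀ y, LinearMap.trace ℝ _
      (fderiv ℝ g y : EuclideanSpace ℝ (Fin 3) →ₗ[ℝ] EuclideanSpace ℝ (Fin 3)) = 0)
    {C a : ℝ} (ha : 2 < a) (hC : 0 ≤ C) (hdec : ∀ y, ‖g y‖ ≤ C * (1 + ‖y‖) ^ (-a)) :
    Conservative (fun q => lipschitzFlow hK q 1) volume := by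
  have ha1 : 1 ≤ a := by linarith
  obtain ⟨f, hf⟩ : ∃ f : EuclideanSpace ℝ (Fin 3) → EuclideanSpace ℝ (Fin 3),
      f = fun q => lipschitzFlow hK q 1 := ⟨_, rfl⟩
  have hmp : MeasurePreserving f volume volume := by
    rw [hf]; exact measurePreserving_flow volume hK hg hdiv zero_le_one
  rw [← hf]
  refine ⟨hmp.quasiMeasurePreserving, fun s hs hμs => ?_⟩
  by_contra hcon
  push Not at hcon
  -- (1) a bounded piece of `s` of positive measure
  obtain ⟨R₀, hR₀, hW0⟩ : ∃ R₀ : ℝ, 0 ≤ R₀ ∧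
      volume (s ∩ closedBall (0 : EuclideanSpace ℝ (Fin 3)) R₀) ≠ 0 := by
    by_contra hall
    push Not at hall
    apply hμs
    have hcov : s ⊆ ⋃ n : ℕ, s ∩ closedBall (0 : EuclideanSpace ℝ (Fin 3)) n := by
      intro x hx
      obtain ⟨n, hn⟩ := exists_nat_ge ‖x‖
      exact mem_iUnion.2 ⟨n, hx, mem_closedBall_zero_iff.2 hn⟩
    exact measure_mono_null hcov (measure_iUnion_null fun n => hall n n.cast_nonneg)
  set W : Set (EuclideanSpace ℝ (Fin 3)) := s ∩ closedBall 0 R₀ with hW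
  have hWm : MeasurableSet W := hs.inter measurableSet_closedBall
  have hWs : W ⊆ s := inter_subset_left
  have hWB : W ⊆ closedBall 0 R₀ := inter_subset_right
  -- (2) the preimages `A k = (f^[k])⁻¹ W`: measurable, of measure `vol W`, pairwise disjoint
  set A : ℕ → Set (EuclideanSpace ℝ (Fin 3)) := fun k => (f^[k]) ⁻¹' W with hA
  have hAm : ∀ k, MeasurableSet (A k) := fun k => (hmp.iterate k).measurable hWm
  have hAμ : ∀ k, volume (A k) = volume W := fun k =>
    (hmp.iterate k).measure_preimage hWm.nullMeasurableSet
  have hdisj : Pairwise (Disjoint on A) := by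
    rw [pairwise_disjoint_on]
    intro j k hjk
    rw [Set.disjoint_left]
    intro x hxj hxk
    have heq : f^[k] x = f^[k - j] (f^[j] x) := by
      rw [← Function.iterate_add_apply, Nat.sub_add_cancel hjk.le]
    have hmem : f^[k - j] (f^[j] x) ∈ s := by rw [← heq]; exact hWs hxk
    exact hcon (f^[j] x) (hWs hxj) (k - j) (Nat.sub_ne_zero_of_lt hjk) hmem
  -- (3) slow escape: `A k ⊆ closedBall 0 (R n)` for `k ≤ n`
  obtain ⟨M, hM⟩ : ∃ M : ℝ, M = (1 + a) * C := ⟨_, rfl⟩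
  have hM0 : 0 ≤ M := by rw [hM]; positivity
  obtain ⟨G₀, hG₀⟩ : ∃ G₀ : ℝ, G₀ = (1 + R₀ ^ 2) ^ ((1 + a) / 2) := ⟨_, rfl⟩
  have hG₀0 : 0 ≤ G₀ := by rw [hG₀]; positivity
  obtain ⟨R, hR⟩ : ∃ R : ℕ → ℝ, R = fun n : ℕ => (G₀ + M * (n : ℝ)) ^ (1 / (1 + a)) :=
    ⟨_, rfl⟩
  have hR0 : ∀ n, 0 ≤ R n := fun n => by rw [hR]; exact Real.rpow_nonneg (by positivity) _
  have hAsub : ∀ n k, k ≤ n → A k ⊆ closedBall (0 : EuclideanSpace ℝ (Fin 3)) (R n) := by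
    intro n k hk x hx
    have hxW : f^[k] x ∈ W := hx
    have hq : f^[k] x = lipschitzFlow hK x k := by
      rw [hf, iterate_flow_slice, mul_one]
    have hxq : x = lipschitzFlow hK (f^[k] x) (-(k : ℝ)) := by
      rw [hq, lipschitzFlow_neg_lipschitzFlow]
    have hgrowth := rpow_norm_flow_le hK ha1 hC hdec (f^[k] x) (-(k : ℝ))
    rw [← hxq, abs_neg, Nat.abs_cast] at hgrowth
    have hqR : ‖f^[k] x‖ ≤ R₀ := mem_closedBall_zero_iff.1 (hWB hxW)
    have h1 : (1 + ‖f^[k] x‖ ^ 2) ^ ((1 + a) / 2) ≤ G₀ := by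
      rw [hG₀]
      exact Real.rpow_le_rpow (by positivity) (by nlinarith [norm_nonneg (f^[k] x)])
        (by positivity)
    have hkn : (1 + a) * C * (k : ℝ) ≤ M * n := by
      rw [hM]
      exact mul_le_mul_of_nonneg_left (Nat.cast_le.2 hk) (by positivity)
    have h2 : (1 + ‖x‖ ^ 2) ^ ((1 + a) / 2) ≤ G₀ + M * n := by linarith
    rw [mem_closedBall_zero_iff, hR]
    exact le_rpow_of_rpow_one_add_sq_le ha1 (norm_nonneg x) h2
  -- (4) counting: `(n+1) vol W ≤ vol (closedBall 0 (R n)) = R n ^ 3 · vol (ball 0 1)`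
  have hcount : ∀ n : ℕ, ((n : ℝ≥0∞) + 1) * volume W ≤
      volume (closedBall (0 : EuclideanSpace ℝ (Fin 3)) (R n)) := by
    intro n
    have hU : (⋃ k ∈ Finset.range (n + 1), A k) ⊆ closedBall (0 : EuclideanSpace ℝ (Fin 3)) (R n) :=
      iUnion₂_subset fun k hk => hAsub n k (Nat.lt_succ_iff.1 (Finset.mem_range.1 hk))
    calc ((n : ℝ≥0∞) + 1) * volume W = ∑ k ∈ Finset.range (n + 1), volume (A k) := by
          simp only [hAμ, Finset.sum_const, Finset.card_range, nsmul_eq_mul]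
          push_cast
          ring
      _ = volume (⋃ k ∈ Finset.range (n + 1), A k) :=
          (measure_biUnion_finset (hdisj.set_pairwise _) fun k _ => hAm k).symm
      _ ≤ volume (closedBall (0 : EuclideanSpace ℝ (Fin 3)) (R n)) := measure_mono hU
  have hball : ∀ n, volume (closedBall (0 : EuclideanSpace ℝ (Fin 3)) (R n)) =
      ENNReal.ofReal (R n ^ 3) * volume (ball (0 : EuclideanSpace ℝ (Fin 3)) 1) := by
    intro n
    rw [Measure.addHaar_closedBall volume (0 : EuclideanSpace ℝ (Fin 3)) (hR0 n),
      finrank_euclideanSpace_fin]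
  have hle : ∀ n : ℕ, volume W ≤
      ENNReal.ofReal (R n ^ 3 / (n + 1)) * volume (ball (0 : EuclideanSpace ℝ (Fin 3)) 1) := by
    intro n
    have hn : (0 : ℝ) < n + 1 := by positivity
    have h := (hcount n).trans_eq (hball n)
    have hcast : ENNReal.ofReal ((n : ℝ) + 1) = (n : ℝ≥0∞) + 1 := by
      rw [ENNReal.ofReal_add (Nat.cast_nonneg n) zero_le_one, ENNReal.ofReal_natCast,
        ENNReal.ofReal_one]
    have hsplit : ENNReal.ofReal (R n ^ 3) =
        ((n : ℝ≥0∞) + 1) * ENNReal.ofReal (R n ^ 3 / (n + 1)) := by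
      rw [← hcast, ← ENNReal.ofReal_mul hn.le]
      congr 1
      field_simp
    rw [hsplit, mul_assoc] at h
    exact (ENNReal.mul_le_mul_iff_right (by simp) (by simp)).1 h
  -- (5) asymptotics: `R n ^ 3 / (n+1) → 0` because `3/(1+a) < 1`
  have hlim : Tendsto (fun n : ℕ => R n ^ 3 / (n + 1)) atTop (𝓝 0) := by
    have he : 3 / (1 + a) < 1 := by rw [div_lt_one (by linarith)]; linarith
    have he0 : 0 < 3 / (1 + a) := by positivity
    have hR3 : ∀ n : ℕ, R n ^ 3 = (G₀ + M * n) ^ (3 / (1 + a)) := by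
      intro n
      rw [hR]
      dsimp only
      rw [← Real.rpow_natCast ((G₀ + M * n) ^ (1 / (1 + a))) 3, ← Real.rpow_mul (by positivity)]
      congr 1
      push_cast
      ring
    obtain ⟨c, hc⟩ : ∃ c : ℝ, c = G₀ + M + 1 := ⟨_, rfl⟩
    have hc0 : 0 < c := by rw [hc]; positivity
    have hbd : ∀ n : ℕ, R n ^ 3 / (n + 1) ≤
        c ^ (3 / (1 + a)) * ((n : ℝ) + 1) ^ (-(1 - 3 / (1 + a))) := by
      intro n
      have hn : (0 : ℝ) < n + 1 := by positivity
      have h1 : G₀ + M * n ≤ c * (n + 1) := by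
        rw [hc]
        nlinarith [hG₀0, hM0, (Nat.cast_nonneg n : (0 : ℝ) ≤ n)]
      have h2 : (G₀ + M * n) ^ (3 / (1 + a)) ≤ (c * (n + 1)) ^ (3 / (1 + a)) :=
        Real.rpow_le_rpow (by positivity) h1 he0.le
      rw [Real.mul_rpow hc0.le hn.le] at h2
      rw [hR3, div_le_iff₀ hn]
      calc (G₀ + M * n) ^ (3 / (1 + a)) ≤ c ^ (3 / (1 + a)) * ((n : ℝ) + 1) ^ (3 / (1 + a)) := h2
        _ = c ^ (3 / (1 + a)) * ((n : ℝ) + 1) ^ (-(1 - 3 / (1 + a))) * ((n : ℝ) + 1) := by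
            rw [mul_assoc, ← Real.rpow_add_one hn.ne']
            congr 2
            ring
    have hlim0 : Tendsto (fun n : ℕ => c ^ (3 / (1 + a)) * ((n : ℝ) + 1) ^ (-(1 - 3 / (1 + a))))
        atTop (𝓝 0) := by
      have h := (tendsto_rpow_neg_atTop (by linarith : 0 < 1 - 3 / (1 + a))).comp
        (tendsto_atTop_add_const_right atTop (1 : ℝ) tendsto_natCast_atTop_atTop)
      simpa using h.const_mul (c ^ (3 / (1 + a)))
    exact squeeze_zero (fun n => div_nonneg (pow_nonneg (hR0 n) 3) (by positivity)) hbd hlim0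
  -- (6) `vol W = 0`: contradiction
  have hlimE : Tendsto (fun n : ℕ => ENNReal.ofReal (R n ^ 3 / (n + 1)) *
      volume (ball (0 : EuclideanSpace ℝ (Fin 3)) 1)) atTop (𝓝 0) := by
    have h1 : Tendsto (fun n : ℕ => ENNReal.ofReal (R n ^ 3 / (n + 1))) atTop (𝓝 0) := by
      simpa using ENNReal.tendsto_ofReal hlim
    have h2 := ENNReal.Tendsto.mul_const h1
      (Or.inr (measure_ball_lt_top : volume (ball (0 : EuclideanSpace ℝ (Fin 3)) 1) < ⊤).ne)
    simpa using h2
  have hW0' : volume W ≤ 0 := ge_of_tendsto' hlimE hle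
  exact hW0 (nonpos_iff_eq_zero.1 hW0')

end Conservative

end DecayFlux

open Literature.Analysis.FluidPDE in
/-- **Item `RotatedEulerWindow.DecayFluxRecurrence` (stmt-NavierStokesRegularity-19348).** For a
`C¹`, globally Lipschitz vorticity field `Ω = m⁻¹ curl U` (`U ∈ C²`, so `div Ω = 0`) with the decay
`‖Ω y‖ ≤ C (1 + ‖y‖)^(-1/β)`, `0 < β < 1/2`, almost every point is forward-recurrent along its vortex
line: every integral curve `x` of `Ω` with `x 0 = y` returns to every `ε`-ball about `y` at
arbitrarily late times. Proof: Liouville (the flow preserves Lebesgue measure) + slow escape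
(`a = 1/β > 2`) ⇒ the time-one map is conservative (`DecayFlux.conservative_flow_one`) ⇒ a.e.
recurrence at integer times (Mathlib `Conservative.ae_frequently_mem_of_mem_nhds`) ⇒ recurrence of
the (unique) integral curve. The guard `Ω y ≠ 0` is not used. -/
theorem rotatedEulerWindow_decayFluxRecurrence_proof :
    Theses.RotatedEulerWindow.DecayFluxRecurrence := by
  intro β U Ω hβ hβ2 hU hΩ hm hLip hdec
  obtain ⟨m, hm0, hmΩ⟩ := hm
  obtain ⟨L, hL⟩ := hLip
  obtain ⟨C, hC⟩ := hdec
  have ha : 2 < 1 / β := by rw [lt_div_iff₀ hβ]; linarith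
  have hC0 : 0 ≤ C := by
    have h := hC 0
    simp only [norm_zero, add_zero, Real.one_rpow, mul_one] at h
    exact (norm_nonneg _).trans h
  -- `div Ω = 0` (`Ω = m⁻¹ curl U`, `div curl = 0`)
  have hdiv : ∀ y, LinearMap.trace ℝ _
      (fderiv ℝ Ω y : EuclideanSpace ℝ (Fin 3) →ₗ[ℝ] EuclideanSpace ℝ (Fin 3)) = 0 := by
    intro y
    have hcurl : Literature.Analysis.FluidPDE.curl U = fun y => m • Ω y := (funext hmΩ).symm
    have h1 : fderiv ℝ (Literature.Analysis.FluidPDE.curl U) y = m • fderiv ℝ Ω y := by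
      rw [hcurl]
      exact fderiv_const_smul ((hΩ.differentiable (by simp)) y) m
    have h2 : VectorCalculus.divergence (Literature.Analysis.FluidPDE.curl U) y = 0 :=
      divergence_curl_eq_zero_holds U hU y
    unfold VectorCalculus.divergence at h2
    rw [h1] at h2
    have h3 : m * LinearMap.trace ℝ _
        (fderiv ℝ Ω y : EuclideanSpace ℝ (Fin 3) →ₗ[ℝ] EuclideanSpace ℝ (Fin 3)) = 0 := by
      simpa using h2
    exact (mul_eq_zero.1 h3).resolve_left hm0.ne'
  have hcons := DecayFlux.conservative_flow_one hL hΩ hdiv ha hC0 hC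
  filter_upwards [hcons.ae_frequently_mem_of_mem_nhds] with y hy
  intro _ x hx0 hx ε hε S
  -- the integral curve is the flow line
  have hxflow : ∀ s, x s = lipschitzFlow hL y s := by
    intro s
    have h := eq_lipschitzFlow_of_hasDerivAt hL (a := -(|s| + 1)) (b := |s| + 1) (t₀ := 0)
      ⟨by linarith [abs_nonneg s], by linarith [abs_nonneg s]⟩ (fun t _ => hx t) (t := s)
      ⟨by linarith [neg_abs_le s], by linarith [le_abs_self s]⟩
    rw [hx0, sub_zero] at h
    exact h
  -- recurrence at integer times
  obtain ⟨n, hn, hmem⟩ :=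
    (hy (ball y ε) (ball_mem_nhds y hε)).forall_exists_of_atTop (⌈S⌉₊ + 1)
  refine ⟨n, ?_, ?_⟩
  · have h1 : S ≤ ⌈S⌉₊ := Nat.le_ceil S
    have h2 : ((⌈S⌉₊ + 1 : ℕ) : ℝ) ≤ n := Nat.cast_le.2 hn
    push_cast at h2
    linarith
  · rw [hxflow n]
    have h := DecayFlux.iterate_flow_slice hL 1 n y
    rw [mul_one] at h
    rw [← h]
    exact mem_ball.1 hmem

end Summit.NavierStokesRegularity.NavierStokesRegularity.Theorems

end
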